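import Mathlib.Analysis.Calculus.LineDeriv.IntegrationByParts
import Mathlib.Analysis.SpecialFunctions.ExpDeriv
import Mathlib.Analysis.Calculus.ContDiff.Operations
import Mathlib.MeasureTheory.Function.LocallyIntegrable
import Literature.Geometry.Lorentzian.KerrSchild
import HarnessLib

/-!
# The oscillatory cross term of the energy of a real Gaussian beam: one integration by parts
(trunk G08 = T-LORENTZ, geometric optics; namespace `Literature.Geometry.Lorentzian.GaussianBeam`)

The energy density of the real part `Re(a e^{iλφ})` of a Gaussian beam is the sum of a
non-oscillatory term `½ e^{-2λ Im φ}(…)` and an oscillatory one `½ Re(e^{2iλφ}(…))`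
(`GaussianBeamEnergyDensity.lean`, `normalCurrent_re_beam`). Sbierski (Anal. PDE 8 (2015), third
remark after the theorem of §4) notes that for real beams "the result […] also holds true […] and
can be proved using exactly the same technique — only the computations become a bit longer, since
we have to deal with more terms". The extra terms are integrals `∫_{Σ_τ} b e^{2iλφ} dy` with `b`
smooth, compactly supported and polynomial in `λ` of degree `≤ 2`; since `d_yφ ≠ 0` on the beam
(it equals the spatial momentum `p⃗ ≠ 0` on the geodesic), **one integration by parts** along a
constant direction `Z` with `∂_Zφ ≠ 0` on `supp b`,

  `∫ b e^{2iλφ} = −(2iλ)⁻¹ ∫ ∂_Z(b/∂_Zφ) e^{2iλφ}`,   `|e^{2iλφ}| = e^{-2λ Im φ}`,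

gains a factor `λ⁻¹` without differentiating the Gaussian `e^{-2λ Im φ}` (which stays inside the
complex exponential), so that these terms are `O(λ² · λ⁻¹ · λ^{-3/2}) = O(λ^{-1/2})`, negligible
against the energy `≍ λ^{1/2}`. This file proves the identity and the resulting bound on `E3`
(Mathlib's `integral_mul_fderiv_eq_neg_fderiv_mul_of_integrable`):

* `GaussianBeam.oscQuot b Φ Z = b / ∂_ZΦ`, its `C¹` regularity and compact support
  (`contDiff_oscQuot`, `hasCompactSupport_oscQuot`);
* `integral_mul_cexp_eq` — the integration-by-parts identity;
* `norm_integral_mul_cexp_le` — `‖∫ b e^{2iλΦ}‖ ≤ (2λ)⁻¹ ∫ ‖∂_Z(b/∂_ZΦ)‖ e^{-2λ Im Φ}`.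

## References

* J. Sbierski, *Characterisation of the energy of Gaussian beams on Lorentzian manifolds: with
  applications to black hole spacetimes*, Anal. PDE 8 (2015) 1379–1420, §4, third remark after the
  theorem; arXiv:1311.2477v2 §2.3 (key `Sbierski2015`).
-/

noncomputable section

open Set Filter MeasureTheory Complex
open scoped ContDiff Topology

namespace Literature.Geometry.Lorentzian

namespace GaussianBeam

variable {b Φ : E3 → ℂ} (Z : E3)

/-- The quotient `b / ∂_ZΦ` of the integration by parts. [folklore] -/
def oscQuot (b Φ : E3 → ℂ) (Z : E3) (y : E3) : ℂ := b y / fderiv ℝ Φ y Z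

/-- `b = (b/∂_ZΦ) · ∂_ZΦ` everywhere, if `∂_ZΦ ≠ 0` on the support of `b`. [folklore] -/
theorem oscQuot_mul (hZ : ∀ y ∈ tsupport b, fderiv ℝ Φ y Z ≠ 0) (y : E3) :
    oscQuot b Φ Z y * fderiv ℝ Φ y Z = b y := by
  by_cases hy : b y = 0
  · simp [oscQuot, hy]
  · exact div_mul_cancel₀ (b y) (hZ y (subset_tsupport _ hy))

/-- The quotient is supported in the support of `b`. [folklore] -/
theorem support_oscQuot_subset : Function.support (oscQuot b Φ Z) ⊆ Function.support b := by
  intro y hy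
  simp only [Function.mem_support] at hy ⊢
  contrapose! hy
  simp [oscQuot, hy]

/-- The quotient has compact support. [folklore] -/
theorem hasCompactSupport_oscQuot (hbs : HasCompactSupport b) : HasCompactSupport (oscQuot b Φ Z) :=
  hbs.mono (support_oscQuot_subset Z)

/-- The support of the quotient lies in that of `b`. [folklore] -/
theorem tsupport_oscQuot_subset : tsupport (oscQuot b Φ Z) ⊆ tsupport b :=
  closure_mono (support_oscQuot_subset Z)

/-- **The quotient is `C¹`** for `b ∈ C¹_c`, `Φ ∈ C²` with `∂_ZΦ ≠ 0` on `tsupport b` (off the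
support it vanishes identically near every point). [folklore] -/
theorem contDiff_oscQuot (hb : ContDiff ℝ 1 b) (hΦ : ContDiff ℝ 2 Φ)
    (hZ : ∀ y ∈ tsupport b, fderiv ℝ Φ y Z ≠ 0) : ContDiff ℝ 1 (oscQuot b Φ Z) := by
  have hΦZ : ContDiff ℝ 1 fun y ↦ fderiv ℝ Φ y Z :=
    (hΦ.fderiv_right (m := 1) le_rfl).clm_apply contDiff_const
  have hfun : oscQuot b Φ Z = fun y ↦ b y * (fderiv ℝ Φ y Z)⁻¹ := by
    funext y; rw [oscQuot, div_eq_mul_inv]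
  rw [hfun, contDiff_iff_contDiffAt]
  intro y
  by_cases hy : y ∈ tsupport b
  · exact hb.contDiffAt.mul (hΦZ.contDiffAt.inv (hZ y hy))
  · -- `b = 0` near `y`
    have hzero : (fun y ↦ b y * (fderiv ℝ Φ y Z)⁻¹) =ᶠ[𝓝 y] fun _ ↦ 0 := by
      have hopen : IsOpen (tsupport b)ᶜ := (isClosed_tsupport b).isOpen_compl
      filter_upwards [hopen.mem_nhds hy] with z hz
      have : b z = 0 := image_eq_zero_of_notMem_tsupport hz
      simp [this]
    exact (contDiffAt_const (c := (0 : ℂ))).congr_of_eventuallyEq hzero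

/-- The derivative of the oscillatory factor: `∂_Z e^{2iλΦ} = e^{2iλΦ} · 2iλ ∂_ZΦ`. [folklore] -/
theorem fderiv_cexp_apply (hΦ : ContDiff ℝ 2 Φ) (lam : ℝ) (y : E3) :
    fderiv ℝ (fun z ↦ cexp (2 * I * lam * Φ z)) y Z =
      cexp (2 * I * lam * Φ y) * (2 * I * lam * fderiv ℝ Φ y Z) := by
  have hd : DifferentiableAt ℝ Φ y := hΦ.differentiable (by simp) y
  rw [((hd.hasFDerivAt.const_mul (2 * I * lam)).cexp).fderiv]
  simp [smul_eq_mul]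

/-- `|e^{2iλΦ}| = e^{-2λ Im Φ}`. [cite: Sbierski2015, §3 (proof of the second lemma)] -/
theorem norm_cexp_two_I_mul (lam : ℝ) (p : ℂ) :
    ‖cexp (2 * I * lam * p)‖ = Real.exp (-2 * lam * p.im) := by
  rw [Complex.norm_exp]
  congr 1
  simp only [Complex.mul_re, Complex.mul_im, Complex.I_re, Complex.I_im, Complex.ofReal_re,
    Complex.ofReal_im, Complex.re_ofNat, Complex.im_ofNat]
  ring

/-- The oscillatory factor is `C¹` for `Φ ∈ C²`. [folklore] -/
theorem contDiff_cexp_phase (hΦ : ContDiff ℝ 2 Φ) (lam : ℝ) :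
    ContDiff ℝ 1 fun z ↦ cexp (2 * I * lam * Φ z) :=
  (contDiff_const.mul (hΦ.of_le (by norm_num))).cexp

/-- **Integration by parts for the oscillatory cross term**: for `b ∈ C¹_c(E3)`, `Φ ∈ C²(E3)` with
`∂_ZΦ ≠ 0` on `tsupport b`, and `λ ≠ 0`,
`∫ b e^{2iλΦ} = −(2iλ)⁻¹ ∫ ∂_Z(b/∂_ZΦ) e^{2iλΦ}`. [cite: Sbierski2015, §4 (third remark after the theorem)] -/
theorem integral_mul_cexp_eq (hb : ContDiff ℝ 1 b) (hbs : HasCompactSupport b) (hΦ : ContDiff ℝ 2 Φ)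
    (hZ : ∀ y ∈ tsupport b, fderiv ℝ Φ y Z ≠ 0) {lam : ℝ} (hlam : lam ≠ 0) :
    ∫ y, b y * cexp (2 * I * lam * Φ y) =
      -(2 * I * lam)⁻¹ * ∫ y, fderiv ℝ (oscQuot b Φ Z) y Z * cexp (2 * I * lam * Φ y) := by
  have hψd : ContDiff ℝ 1 (oscQuot b Φ Z) := contDiff_oscQuot Z hb hΦ hZ
  have hψs : HasCompactSupport (oscQuot b Φ Z) := hasCompactSupport_oscQuot Z hbs
  have hgd : ContDiff ℝ 1 fun z ↦ cexp (2 * I * lam * Φ z) := contDiff_cexp_phase hΦ lam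
  have hc : (2 * I * (lam : ℂ)) ≠ 0 := by simp [hlam, Complex.I_ne_zero]
  have hl : (lam : ℂ) ≠ 0 := by exact_mod_cast hlam
  -- rewrite the integrand through the quotient
  have hpt : ∀ y, b y * cexp (2 * I * lam * Φ y) =
      (2 * I * lam)⁻¹ * (oscQuot b Φ Z y * fderiv ℝ (fun z ↦ cexp (2 * I * lam * Φ z)) y Z) := by
    intro y
    rw [fderiv_cexp_apply Z hΦ lam y, ← oscQuot_mul Z hZ y]
    field_simp
  simp_rw [hpt]
  rw [integral_const_mul]
  -- integration by parts
  have hψc : Continuous (oscQuot b Φ Z) := hψd.continuous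
  have hψ'c : Continuous fun y ↦ fderiv ℝ (oscQuot b Φ Z) y Z :=
    ((hψd.fderiv_right (m := 0) le_rfl).clm_apply contDiff_const).continuous
  have hgc : Continuous fun z ↦ cexp (2 * I * lam * Φ z) := hgd.continuous
  have hg'c : Continuous fun y ↦ fderiv ℝ (fun z ↦ cexp (2 * I * lam * Φ z)) y Z :=
    ((hgd.fderiv_right (m := 0) le_rfl).clm_apply contDiff_const).continuous
  have hψ's : HasCompactSupport fun y ↦ fderiv ℝ (oscQuot b Φ Z) y Z := hψs.fderiv_apply (𝕜 := ℝ) Z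
  have h1 : Integrable fun y ↦ fderiv ℝ (oscQuot b Φ Z) y Z * cexp (2 * I * lam * Φ y) :=
    (hψ'c.mul hgc).integrable_of_hasCompactSupport hψ's.mul_right
  have h2 : Integrable fun y ↦
      oscQuot b Φ Z y * fderiv ℝ (fun z ↦ cexp (2 * I * lam * Φ z)) y Z :=
    (hψc.mul hg'c).integrable_of_hasCompactSupport hψs.mul_right
  have h3 : Integrable fun y ↦ oscQuot b Φ Z y * cexp (2 * I * lam * Φ y) :=
    (hψc.mul hgc).integrable_of_hasCompactSupport hψs.mul_right
  have hibp := integral_mul_fderiv_eq_neg_fderiv_mul_of_integrable (μ := volume) (v := Z) h1 h2 h3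
    (fun y _ ↦ hψd.differentiable one_ne_zero y) (fun y _ ↦ hgd.differentiable one_ne_zero y)
  rw [hibp]
  ring

/-- **The bound for the oscillatory cross term**: under the same hypotheses, for `λ > 0`,
`‖∫ b e^{2iλΦ}‖ ≤ (2λ)⁻¹ ∫ ‖∂_Z(b/∂_ZΦ)‖ e^{-2λ Im Φ}` — one power of `λ` gained, the Gaussian
`e^{-2λ Im Φ}` undifferentiated. [cite: Sbierski2015, §4 (third remark after the theorem)] -/
theorem norm_integral_mul_cexp_le (hb : ContDiff ℝ 1 b) (hbs : HasCompactSupport b)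
    (hΦ : ContDiff ℝ 2 Φ) (hZ : ∀ y ∈ tsupport b, fderiv ℝ Φ y Z ≠ 0) {lam : ℝ} (hlam : 0 < lam) :
    ‖∫ y, b y * cexp (2 * I * lam * Φ y)‖ ≤
      (2 * lam)⁻¹ * ∫ y, ‖fderiv ℝ (oscQuot b Φ Z) y Z‖ * Real.exp (-2 * lam * (Φ y).im) := by
  rw [integral_mul_cexp_eq Z hb hbs hΦ hZ hlam.ne', norm_mul, norm_neg, norm_inv]
  have hn : ‖(2 * I * (lam : ℂ))‖ = 2 * lam := by
    rw [norm_mul, norm_mul, Complex.norm_I, Complex.norm_real, Real.norm_eq_abs,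
      abs_of_pos hlam]
    simp
  rw [hn]
  refine mul_le_mul_of_nonneg_left ?_ (by positivity)
  refine (norm_integral_le_integral_norm _).trans (le_of_eq ?_)
  congr 1
  funext y
  rw [norm_mul, norm_cexp_two_I_mul]

end GaussianBeam

end Literature.Geometry.Lorentzian
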